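import Summits.CriticalPhenomena.PercolationContinuityZ3.Theorems.Transplant.PlanarCells2LevelsV
import Summits.CriticalPhenomena.PercolationContinuityZ3.Theorems.Transplant.PlanarCells2EfarN2
import HarnessLib

/-!
J23/(R-45) SUCCESSOR `…V` (hp-8 g42, 2026-08-23; ruling lead g12 11:31:15Z, design owner p3-g17 (R-44)/(R-45)): the twin of `PlanarCells2EfarN2T` over the cell structure with
per-axis ASYMMETRIC transverse rooms `PCells2V` (PlanarCells2VDefs: the slab family `Stub/Zone/Face/Hfull/faceLo/faceHi` has transverse interval `σ·[−hB∥, hF∥]`,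
`hB, hF ≤ 2r⊥`, instead of `[−2r⊥, 2r⊥]`; every other box verbatim); statements and proofs VERBATIM with `PCells2T ↦ PCells2V` (+ the renames of record of the
V layer below it); the only mathematical touch points are the places that read the symmetric transverse room (listed in the lane line of this file's landing).
NO landed file is edited; `PlanarCells2EfarN2T` stays valid (it is the instance `PCells2T.toV`, `hB = hF = 2r⊥`). NON-VACUITY: inherited verbatim from `PlanarCells2EfarN2T` (same witness line).

(R-40) SUCCESSOR `…T` (hp-8 g42, 2026-08-23; ruling p3-g16 06:23:56Z, J18): the twin of `PlanarCells2EfarN2S` over the PER-AXIS creep cap `PCells2V` (PlanarCells2TDefs: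
`c i ≤ r (oth i)` instead of the uniform `c i ≤ cmax ≤ r j`); statements and proofs VERBATIM with `PCells2S ↦ PCells2V` (+ the renames of record of the T layer below it);
the only mathematical touch points are the places that read the cap, which only ever need the cross form `c (oth j) ≤ r j` (listed in the lane line of this file's landing).
NO landed file is edited; `PlanarCells2EfarN2S` stays valid (and is an instance of this file through `PCells2S.toT`). NON-VACUITY: inherited verbatim from `PlanarCells2EfarN2S` (same witness line).

# STAGGERED two-unit planar cells `PCells2V`: THE SLACK FAR REGION OF RECORD `FarNS₂ = BtwNS₂ ∪ QNS v δ 2`, the slack boxes a weak step lands in,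
# and the one-shared-level margins — the `PCells2V` twin of `PlanarCells2EfarN2` ((R-27) far block follows the neighbour, (R-29) arms shrunk by the creep)

WAVE-1 Geom re-base (typer p3-g15).  hp-8 g33's D″ cover argument (`cellGeomSG₂.Efar_subset_Btw_union_Q`: from a point of the far region step UP at
the bottom row of a block and DOWN otherwise, the weak step's box lying in ONE box) survives the two-block shape because the proof never steps from the
neighbour's block (levels `≥ 15r∥`, about `cenS (v+δ)`, across `5r⊥ − 2`) down into the between block (levels `≤ 15r∥ − 1`, about `cenS v`, across
`5r⊥ − 2 − c`): at level `15r∥` it steps up.  So: `lev_bounds_of_mem_FarNS₂` hands out the across bound OF THE BLOCK the level selects; the slack boxes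
into `BtwNS` are about `cenS v` with the creep-shrunk width, those into `Q (v+δ)` about `cenS (v+δ)`; corridor points (across `2r⊥` about `cenS v`)
up-step inside `FarNS₂` in both blocks (`2r⊥ + 1 + c ≤ 5r⊥ − 2`, as `r⊥ ≥ 20`).  §3: `adjMargin_BtwNS_Cells`, `adjMargin_Stub_Cell_Zone` over `cenS`
(shared level `10r∥`; the creep `|σc| ≤ r⊥` is absorbed by the cells' width).  Statements in explicit-application form `PCells2V.X P …`.
builds on p205010 (kernel theorem, internal audit signed; external expert review pending) — nothing here uses p205010 or claims anything about the open node.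
Lane `prim-bschramm`, seat `prim-bschramm-p3` (gen 15; N2 design owner); helper file (`--supports stmt-CriticalPhenomena-4575 --as helper`).
[cite: KozmaNitzan2024, §4 pp. 25–26 (Q_v, E_{v,x}, H_{v,x}), p. 30] [folklore]
-/

noncomputable section

namespace Summit.CriticalPhenomena.PercolationContinuityZ3.Theorems.Transplant

open Literature.Probability.Percolation Literature.Probability.LatticeModels
open Literature.Probability.Percolation.KozmaNitzan
open Literature.Probability.Percolation.KozmaNitzan.Cells (oth oth_ne sgOf sgOf_sign stepVec_apply_fst stepVec_apply_oth eq_oth_of_ne oth_oth)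
open PCells (mem_psBox_iff)

namespace PCells2V

variable (P : PCells2V)

/-! ## §1 The slack far region of record -/

/-- **Level and across bounds of a point of `FarNS₂`**: levels in `[5r∥+1, 25r∥]`; in the between block (level `≤ 15r∥ − 1`) the across offset from
`cenS v` is `≤ 5r⊥ − 2 − c δ.1`, in the neighbour's block (level `≥ 15r∥`) the across offset from `cenS (v+δ)` is `≤ 5r⊥ − 2`. [folklore] -/
theorem lev_bounds_of_mem_FarNS₂ {v : Site 2} {δ : MDir} {t : Site 2} (ht : t ∈ PCells2V.FarNS₂ P v δ) :
    5 * (P.r δ.1 : ℤ) + 1 ≤ PCells2V.lev P δ v t ∧ PCells2V.lev P δ v t ≤ 25 * P.r δ.1 ∧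
      (PCells2V.lev P δ v t ≤ 15 * P.r δ.1 - 1 → |t (oth δ.1) - P.cenS v (oth δ.1)| ≤ 5 * P.r (oth δ.1) - 2 - P.c δ.1) ∧
      (15 * (P.r δ.1 : ℤ) ≤ PCells2V.lev P δ v t → |t (oth δ.1) - P.cenS (v + stepVec δ) (oth δ.1)| ≤ 5 * P.r (oth δ.1) - 2) := by
  rw [FarNS₂, Finset.mem_union] at ht
  unfold lev
  have hr := P.one_le_r δ.1
  rcases ht with ht | ht
  · rw [mem_BtwNS₂_iff] at ht
    obtain ⟨⟨h1, h2⟩, h3, h4⟩ := ht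
    exact ⟨h1, by omega, fun _ => abs_le.2 ⟨by omega, by omega⟩, fun h => by omega⟩
  · rw [mem_QNS_iff] at ht
    obtain ⟨⟨h1, h2⟩, h3, h4⟩ := ht
    rw [P.cenS_add_stepVec_fst] at h1 h2
    push_cast at h3 h4
    refine ⟨?_, ?_, fun h => ?_, fun _ => abs_le.2 ⟨by omega, by omega⟩⟩
    · rcases sgOf_sign δ with hs | hs <;> rw [hs] at h1 ⊢ <;> nlinarith
    · rcases sgOf_sign δ with hs | hs <;> rw [hs] at h2 ⊢ <;> nlinarith
    · exfalso; rcases sgOf_sign δ with hs | hs <;> rw [hs] at h1 h <;> nlinarith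

/-- **A corridor point of level `≥ 5r∥ + 1` lies in `FarNS₂`** (across `2r⊥` about `cenS v`; `2r⊥ + c ≤ 5r⊥ − 2` as `c ≤ r⊥`, `r⊥ ≥ 20`). [folklore] -/
theorem mem_FarNS₂_of_mem_Hfull {δ : MDir} {v t : Site 2} (ht : t ∈ PCells2V.Hfull P v δ) (hl : 5 * (P.r δ.1 : ℤ) + 1 ≤ PCells2V.lev P δ v t) :
    t ∈ PCells2V.FarNS₂ P v δ := by
  rw [Hfull, mem_psBoxA_iff] at ht
  obtain ⟨⟨h1, h2⟩, h3, h4⟩ := ht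
  obtain ⟨h3, h4⟩ := P.across_2r_of_signed h3 h4
  unfold lev at hl
  have hr1 := P.one_le_r (oth δ.1)
  have h20 := P.twenty_mul_s_le_r (oth δ.1)
  have hs1 := P.hs (oth δ.1)
  have hc := P.c_nonneg δ.1
  have hc' := P.c_le_r_oth δ
  have hg := P.sg_c_bound δ
  rw [FarNS₂, Finset.mem_union, mem_BtwNS₂_iff, mem_QNS_iff, P.cenS_add_stepVec_fst, P.cenS_add_stepVec_oth]
  by_cases hlev : sgOf δ * (t δ.1 - P.cenS v δ.1) ≤ 15 * P.r δ.1 - 1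
  · exact Or.inl ⟨⟨hl, hlev⟩, by omega, by omega⟩
  · right
    push_cast
    refine ⟨?_, by omega, by omega⟩
    rcases sgOf_sign δ with hs | hs <;> rw [hs] at h1 h2 hlev ⊢ <;> constructor <;> nlinarith

/-- A corridor point off `FarNS₂` has level `≤ 5r∥`. [folklore] -/
theorem lev_le_of_mem_Hfull_not_FarNS₂' {δ : MDir} {v t : Site 2} (ht : t ∈ PCells2V.Hfull P v δ) (hn : t ∉ PCells2V.FarNS₂ P v δ) :
    PCells2V.lev P δ v t ≤ 5 * P.r δ.1 := by
  by_contra h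
  exact hn (P.mem_FarNS₂_of_mem_Hfull ht (by omega))

/-- `Hfull ⊆ Q_v ∪ FarNS₂`. [folklore] -/
theorem Hfull_subset_Q_union_FarNS₂ (v : Site 2) (δ : MDir) : PCells2V.Hfull P v δ ⊆ PCells2V.Q P v ∪ PCells2V.FarNS₂ P v δ := by
  intro t ht
  rw [Finset.mem_union]
  by_cases hlev : PCells2V.lev P δ v t ≤ 5 * P.r δ.1
  · left
    rcases Finset.mem_union.1 (P.Hfull_subset_Q_union_FarNS v δ ht) with h | h
    · exact h
    · exact absurd (P.lev_ge_of_mem_FarNS h) (by omega)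
  · exact Or.inr (P.mem_FarNS₂_of_mem_Hfull ht (by omega))

/-! ## §2 Slack boxes: where a weak step from a point lands -/

/-- **Up-box into `BtwNS`** (about `cenS v`, across offset `≤ 5r⊥ − 2 − c`, level in `[5r∥+1, 15r∥−2]`). [folklore] -/
theorem upBox_subset_BtwNS {v : Site 2} {δ : MDir} {t t' : Site 2}
    (htr : |t (oth δ.1) - P.cenS v (oth δ.1)| ≤ 5 * P.r (oth δ.1) - 2 - P.c δ.1)
    (hl : 5 * (P.r δ.1 : ℤ) + 1 ≤ PCells2V.lev P δ v t) (hu : PCells2V.lev P δ v t ≤ 15 * P.r δ.1 - 2)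
    (h1 : PCells2V.lev P δ v t ≤ PCells2V.lev P δ v t') (h2 : PCells2V.lev P δ v t' ≤ PCells2V.lev P δ v t + 1)
    (h3 : |t' (oth δ.1) - t (oth δ.1)| ≤ 1) : t' ∈ PCells2V.BtwNS P v δ := by
  rw [mem_BtwNS_iff]
  unfold lev at hl hu h1 h2
  have := abs_le.1 htr; have := abs_le.1 h3
  exact ⟨⟨by omega, by omega⟩, by omega, by omega⟩

/-- **Down-box into `BtwNS`** (level in `[5r∥+2, 15r∥−1]`). [folklore] -/
theorem downBox_subset_BtwNS {v : Site 2} {δ : MDir} {t t' : Site 2}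
    (htr : |t (oth δ.1) - P.cenS v (oth δ.1)| ≤ 5 * P.r (oth δ.1) - 2 - P.c δ.1)
    (hl : 5 * (P.r δ.1 : ℤ) + 2 ≤ PCells2V.lev P δ v t) (hu : PCells2V.lev P δ v t ≤ 15 * P.r δ.1 - 1)
    (h1 : PCells2V.lev P δ v t' ≤ PCells2V.lev P δ v t) (h2 : PCells2V.lev P δ v t - 1 ≤ PCells2V.lev P δ v t')
    (h3 : |t' (oth δ.1) - t (oth δ.1)| ≤ 1) : t' ∈ PCells2V.BtwNS P v δ := by
  rw [mem_BtwNS_iff]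
  unfold lev at hl hu h1 h2
  have := abs_le.1 htr; have := abs_le.1 h3
  exact ⟨⟨by omega, by omega⟩, by omega, by omega⟩

/-- **Up-box into `Q_{v+δ}`** (about `cenS (v+δ)`: across offset `≤ 5r⊥ − 1`, level from `v` in `[15r∥, 25r∥−1]`). [folklore] -/
theorem upBox_subset_Q_add {v : Site 2} {δ : MDir} {t t' : Site 2}
    (htr : |t (oth δ.1) - P.cenS (v + stepVec δ) (oth δ.1)| ≤ 5 * P.r (oth δ.1) - 1)
    (hl : 15 * (P.r δ.1 : ℤ) ≤ PCells2V.lev P δ v t) (hu : PCells2V.lev P δ v t ≤ 25 * P.r δ.1 - 1)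
    (h1 : PCells2V.lev P δ v t ≤ PCells2V.lev P δ v t') (h2 : PCells2V.lev P δ v t' ≤ PCells2V.lev P δ v t + 1)
    (h3 : |t' (oth δ.1) - t (oth δ.1)| ≤ 1) : t' ∈ PCells2V.Q P (v + stepVec δ) := by
  rw [Q, mem_aboxS_iff]
  unfold lev at hl hu h1 h2
  have := abs_le.1 htr; have := abs_le.1 h3
  have hf := P.cenS_add_stepVec_fst v δ
  intro i
  rcases eq_or_ne i δ.1 with rfl | hi
  · rw [hf]; rcases sgOf_sign δ with hs | hs <;> rw [hs] at hl hu h1 h2 ⊢ <;> push_cast <;> constructor <;> omega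
  · rw [eq_oth_of_ne hi]; push_cast; constructor <;> omega

/-- **Down-box into `Q_{v+δ}`** (level in `[15r∥+1, 25r∥]`). [folklore] -/
theorem downBox_subset_Q_add {v : Site 2} {δ : MDir} {t t' : Site 2}
    (htr : |t (oth δ.1) - P.cenS (v + stepVec δ) (oth δ.1)| ≤ 5 * P.r (oth δ.1) - 1)
    (hl : 15 * (P.r δ.1 : ℤ) + 1 ≤ PCells2V.lev P δ v t) (hu : PCells2V.lev P δ v t ≤ 25 * P.r δ.1)
    (h1 : PCells2V.lev P δ v t' ≤ PCells2V.lev P δ v t) (h2 : PCells2V.lev P δ v t - 1 ≤ PCells2V.lev P δ v t')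
    (h3 : |t' (oth δ.1) - t (oth δ.1)| ≤ 1) : t' ∈ PCells2V.Q P (v + stepVec δ) := by
  rw [Q, mem_aboxS_iff]
  unfold lev at hl hu h1 h2
  have := abs_le.1 htr; have := abs_le.1 h3
  have hf := P.cenS_add_stepVec_fst v δ
  intro i
  rcases eq_or_ne i δ.1 with rfl | hi
  · rw [hf]; rcases sgOf_sign δ with hs | hs <;> rw [hs] at hl hu h1 h2 ⊢ <;> push_cast <;> constructor <;> omega
  · rw [eq_oth_of_ne hi]; push_cast; constructor <;> omega

/-- **Down-box into `Q_v`** (about `cenS v`: across offset `≤ 5r⊥ − 1`, level in `[−5r∥+1, 5r∥]`). [folklore] -/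
theorem downBox_subset_Q {v : Site 2} {δ : MDir} {t t' : Site 2}
    (htr : |t (oth δ.1) - P.cenS v (oth δ.1)| ≤ 5 * P.r (oth δ.1) - 1)
    (hl : -(5 * (P.r δ.1 : ℤ)) + 1 ≤ PCells2V.lev P δ v t) (hu : PCells2V.lev P δ v t ≤ 5 * P.r δ.1)
    (h1 : PCells2V.lev P δ v t' ≤ PCells2V.lev P δ v t) (h2 : PCells2V.lev P δ v t - 1 ≤ PCells2V.lev P δ v t')
    (h3 : |t' (oth δ.1) - t (oth δ.1)| ≤ 1) : t' ∈ PCells2V.Q P v := by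
  rw [Q, mem_aboxS_iff]
  unfold lev at hl hu h1 h2
  have := abs_le.1 htr; have := abs_le.1 h3
  intro i
  rcases eq_or_ne i δ.1 with rfl | hi
  · rcases sgOf_sign δ with hs | hs <;> rw [hs] at hl hu h1 h2 <;> push_cast <;> constructor <;> omega
  · rw [eq_oth_of_ne hi]; push_cast; constructor <;> omega

/-- **Up-box into `FarNS₂` from a corridor-width point** (across offset `≤ 2r⊥` about `cenS v`, level in `[5r∥+1, 25r∥−1]`): into the between block
below level `15r∥ − 1`, into the neighbour's block from there on (`2r⊥ + 1 + c ≤ 5r⊥ − 2`). [folklore] -/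
theorem upBox_subset_FarNS₂ {v : Site 2} {δ : MDir} {t t' : Site 2}
    (htr : |t (oth δ.1) - P.cenS v (oth δ.1)| ≤ 2 * P.r (oth δ.1))
    (hl : 5 * (P.r δ.1 : ℤ) + 1 ≤ PCells2V.lev P δ v t) (hu : PCells2V.lev P δ v t ≤ 25 * P.r δ.1 - 1)
    (h1 : PCells2V.lev P δ v t ≤ PCells2V.lev P δ v t') (h2 : PCells2V.lev P δ v t' ≤ PCells2V.lev P δ v t + 1)
    (h3 : |t' (oth δ.1) - t (oth δ.1)| ≤ 1) : t' ∈ PCells2V.FarNS₂ P v δ := by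
  unfold lev at hl hu h1 h2
  have := abs_le.1 htr; have := abs_le.1 h3
  have hr1 := P.one_le_r (oth δ.1)
  have h20 := P.twenty_mul_s_le_r (oth δ.1)
  have hs1 := P.hs (oth δ.1)
  have hc := P.c_nonneg δ.1
  have hc' := P.c_le_r_oth δ
  have hg := P.sg_c_bound δ
  rw [FarNS₂, Finset.mem_union, mem_BtwNS₂_iff, mem_QNS_iff, P.cenS_add_stepVec_fst, P.cenS_add_stepVec_oth]
  by_cases hlev : sgOf δ * (t' δ.1 - P.cenS v δ.1) ≤ 15 * P.r δ.1 - 1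
  · exact Or.inl ⟨⟨by omega, hlev⟩, by omega, by omega⟩
  · right
    push_cast
    refine ⟨?_, by omega, by omega⟩
    rcases sgOf_sign δ with hs | hs <;> rw [hs] at hl hu h1 h2 hlev ⊢ <;> constructor <;> nlinarith

/-- Across offset and level range of a corridor point (`Hfull`: across `2r⊥`, levels `[5r∥, 22r∥]`). [folklore] -/
theorem bounds_of_mem_Hfull {v : Site 2} {δ : MDir} {t : Site 2} (ht : t ∈ PCells2V.Hfull P v δ) :
    |t (oth δ.1) - P.cenS v (oth δ.1)| ≤ 2 * P.r (oth δ.1) ∧ 5 * (P.r δ.1 : ℤ) ≤ PCells2V.lev P δ v t ∧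
      PCells2V.lev P δ v t ≤ 22 * P.r δ.1 := by
  rw [Hfull, mem_psBoxA_iff] at ht
  unfold lev
  exact ⟨abs_le.2 ⟨by linarith [(P.across_2r_of_signed ht.2.1 ht.2.2).1], by linarith [(P.across_2r_of_signed ht.2.1 ht.2.2).2]⟩, ht.1.1, ht.1.2⟩

/-- Across offset and level range of a stub point (`Stub j`, `j < K`: levels `[5r∥, 15r∥ − 10s∥]`). [folklore] -/
theorem bounds_of_mem_Stub {v : Site 2} {δ : MDir} {j : ℕ} (hj : j < P.K) {t : Site 2} (ht : t ∈ PCells2V.Stub P v δ j) :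
    |t (oth δ.1) - P.cenS v (oth δ.1)| ≤ 2 * P.r (oth δ.1) ∧ 5 * (P.r δ.1 : ℤ) ≤ PCells2V.lev P δ v t ∧
      PCells2V.lev P δ v t ≤ 15 * P.r δ.1 - 10 * P.s δ.1 := by
  rw [Stub, mem_psBoxA_iff] at ht
  unfold lev
  have hrK : (P.r δ.1 : ℤ) = P.K * P.s δ.1 := P.r_eq δ.1
  have hs1 : (1 : ℤ) ≤ P.s δ.1 := by exact_mod_cast P.hs δ.1
  have hjK : (j : ℤ) + 1 ≤ P.K := by exact_mod_cast hj
  refine ⟨abs_le.2 ⟨by linarith [(P.across_2r_of_signed ht.2.1 ht.2.2).1], by linarith [(P.across_2r_of_signed ht.2.1 ht.2.2).2]⟩, ht.1.1, ht.1.2.trans ?_⟩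
  nlinarith

/-! ## §3 Margins across a shared level -/

/-- **`BtwNS ⊆ Cell v ∪ Cell (v+δ)` with the adjacency margin** (shared level `10r∥`; across, the creep `|σc| ≤ r⊥` is inside the cells). [folklore] -/
theorem adjMargin_BtwNS_Cells (v : Site 2) (δ : MDir) :
    Skelφ.AdjMargin (PCells2V.BtwNS P v δ) (PCells2V.Cell P v) (PCells2V.Cell P (v + stepVec δ)) := by
  have hf := P.cenS_add_stepVec_fst v δ
  have ho := P.cenS_add_stepVec_oth v δ
  have hg := P.sg_c_bound δ
  have hc := P.c_nonneg δ.1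
  have hCv : ∀ s ∈ PCells2V.BtwNS P v δ, sgOf δ * (s δ.1 - P.cenS v δ.1) ≤ 10 * P.r δ.1 → s ∈ PCells2V.Cell P v := by
    intro s hs hle
    rw [mem_BtwNS_iff] at hs
    rw [Cell, mem_aboxS_iff]
    intro i
    rcases eq_or_ne i δ.1 with rfl | hi
    · rcases sgOf_sign δ with h | h <;> rw [h] at hs hle <;> push_cast <;> constructor <;> omega
    · rw [eq_oth_of_ne hi]; push_cast; constructor <;> omega
  have hCw : ∀ s ∈ PCells2V.BtwNS P v δ, 10 * (P.r δ.1 : ℤ) ≤ sgOf δ * (s δ.1 - P.cenS v δ.1) → s ∈ PCells2V.Cell P (v + stepVec δ) := by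
    intro s hs hge
    rw [mem_BtwNS_iff] at hs
    rw [Cell, mem_aboxS_iff]
    intro i
    rcases eq_or_ne i δ.1 with rfl | hi
    · rw [hf]; rcases sgOf_sign δ with h | h <;> rw [h] at hs hge ⊢ <;> push_cast <;> constructor <;> omega
    · rw [eq_oth_of_ne hi, ho]; push_cast; constructor <;> omega
  rcases sgOf_sign δ with h | h
  · refine Skelφ.adjMargin_of_threshold_le δ.1 (P.cenS v δ.1 + 10 * P.r δ.1) (fun s hs hle => hCv s hs ?_) (fun s hs hge => hCw s hs ?_)
    · rw [h]; omega
    · rw [h]; omega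
  · refine Skelφ.adjMargin_of_threshold_ge δ.1 (P.cenS v δ.1 - 10 * P.r δ.1) (fun s hs hge => hCv s hs ?_) (fun s hs hle => hCw s hs ?_)
    · rw [h]; omega
    · rw [h]; omega

/-- **`Stub_j ⊆ Cell v ∪ Zone` with the adjacency margin** (`j < K`; shared level `10r∥`). [folklore] -/
theorem adjMargin_Stub_Cell_Zone (v : Site 2) (δ : MDir) {j : ℕ} (hj : j < P.K) :
    Skelφ.AdjMargin (PCells2V.Stub P v δ j) (PCells2V.Cell P v) (PCells2V.Zone P v δ) := by
  have hCv : ∀ s ∈ PCells2V.Stub P v δ j, sgOf δ * (s δ.1 - P.cenS v δ.1) ≤ 10 * P.r δ.1 → s ∈ PCells2V.Cell P v := by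
    intro s hs hle
    have hb := P.bounds_of_mem_Stub hj hs
    have htr := abs_le.1 hb.1
    unfold lev at hb
    rw [Cell, mem_aboxS_iff]
    intro i
    rcases eq_or_ne i δ.1 with rfl | hi
    · rcases sgOf_sign δ with h | h <;> rw [h] at hb hle <;> push_cast <;> constructor <;> omega
    · rw [eq_oth_of_ne hi]; push_cast; constructor <;> omega
  have hZ : ∀ s ∈ PCells2V.Stub P v δ j, 10 * (P.r δ.1 : ℤ) ≤ sgOf δ * (s δ.1 - P.cenS v δ.1) → s ∈ PCells2V.Zone P v δ := by
    intro s hs hge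
    have hb := P.bounds_of_mem_Stub hj hs
    rw [Stub, mem_psBoxA_iff] at hs
    unfold lev at hb
    rw [Zone, mem_psBoxA_iff]
    exact ⟨⟨hge, hb.2.2⟩, hs.2⟩
  rcases sgOf_sign δ with h | h
  · refine Skelφ.adjMargin_of_threshold_le δ.1 (P.cenS v δ.1 + 10 * P.r δ.1) (fun s hs hle => hCv s hs ?_) (fun s hs hge => hZ s hs ?_)
    · rw [h]; omega
    · rw [h]; omega
  · refine Skelφ.adjMargin_of_threshold_ge δ.1 (P.cenS v δ.1 - 10 * P.r δ.1) (fun s hs hge => hCv s hs ?_) (fun s hs hle => hZ s hs ?_)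
    · rw [h]; omega
    · rw [h]; omega

end PCells2V

end Summit.CriticalPhenomena.PercolationContinuityZ3.Theorems.Transplant

end
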